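import Summits.CriticalPhenomena.PercolationContinuityZ3.Theorems.Transplant.KNCellsBoxProdZ2ChainRoom
import HarnessLib

/-!
# Straight-run planar schedule, ROOTED variant `AdvR`: region `0` extends only `3q + s₁ + 2R'` below the start box (instead of the transverse
# half-width `ρ`), so that a run may start right above forbidden territory — the pinned stub below a face-step contact (p3-g2's
# `advRoute_of_contact`, the elongated deep routes of Step III realised as an inner chain) or the wired root cube

builds on p205010 (kernel theorem, internal audit signed; external expert review pending) — nothing in this file uses p205010.
Lane `prim-bschramm`, seat `prim-bschramm-p2` (advRoute_of_contact, part 1); helper file (`--supports stmt-CriticalPhenomena-4575`).  Pure `Site 2` geometry.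

Cores, parameters and `AdvOK` are those of `ChainPlanar.Adv` (KNCells2ChainAdv); only the region of step `0` changes:
`regionR 0 = sBox a σ c (-(3q + s₁ + 2R')) (q + s₁) ρ` (`route_start` already confines the start routes to these levels).
* `route_start₂` (the start route with separate longitudinal / transverse extents); `Adv.ρ₀`, `Adv.regionR`, `regionR_of_ne_zero`;
* **`core_routeR_le`** (routes with `ℓ ∈ [ℓ₀, 2q + s₁ + R']`), `enlarge_core_subset_regionR`, `core_succ_subset_regionR`, **`regionR_subset_prism`**
  (all regions inside `sBox a σ c (-(3q + s₁ + 2R')) (q + (N+1)s₁) ρ`).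
[cite: KozmaNitzan2024, §4 Lemma 11 (pp. 22–23)]
-/

noncomputable section

namespace Summit.CriticalPhenomena.PercolationContinuityZ3.Theorems

namespace Transplant

namespace ChainPlanar

open Literature.Probability.Percolation Literature.Probability.LatticeModels
open Literature.Probability.Percolation.KozmaNitzan
open Literature.Probability.Percolation.KozmaNitzan.Cells (oth oth_ne eq_oth_of_ne)

/-- **ROUTE FOR THE START STEP, two extents**: as `route_start`, with the square confined to the levels `[-(3q + s + 2R'), q + s]` and the
transverse band `ρ ≥ q' + 2q + s + 2R'`. [cite: KozmaNitzan2024, §4 Lemma 11 (pp. 22–23)] -/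
theorem route_start₂ {a : Fin 2} {σ : ℤ} (hσ : σ = 1 ∨ σ = -1) (c : Site 2) {q q' s w₁ ρ : ℤ} {R' ℓ₀ : ℕ}
    (hs : (R' : ℤ) + ℓ₀ ≤ s) (hw₁ : q' + 2 * q + s + 2 * R' ≤ w₁) (hρ : q' + 2 * q + s + 2 * R' ≤ ρ)
    (hρ' : 3 * q + s + 2 * R' ≤ ρ)
    {v : Site 2} (hv : v ∈ sBox a σ c (-q - R') (q + R') (q' + R')) :
    ∃ ℓ : ℕ, ℓ₀ ≤ ℓ ∧ (ℓ : ℤ) ≤ 2 * q + s + R' ∧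
      shiftF v (box 2 ℓ) ⊆ sBox a σ c (-(3 * q + s + 2 * R')) (q + s) ρ ∧
      ∃ τ : Fin 2 → ℤˣ, shiftF v (orthantFace a τ ℓ) ⊆ sBox a σ c (q + s) (q + s) w₁ := by
  obtain ⟨ℓ, h0, hhi, heq, -, τ, -, hface⟩ := route_start hσ c hs hw₁ hρ hρ' hv
  refine ⟨ℓ, h0, hhi, ?_, τ, hface⟩
  rw [mem_sBox_iff hσ] at hv
  obtain ⟨⟨hv1, hv2⟩, hvj⟩ := hv
  refine shift_box_subset_sBox hσ (by linarith) (by linarith) fun j hj => ?_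
  have := hvj j hj
  constructor <;> linarith [this.1, this.2]

namespace Adv

variable (q q' s₁ ρ : ℤ) (R' N : ℕ)

/-- The longitudinal extent of region `0` below the start box. [folklore] -/
def ρ₀ (q s₁ : ℤ) (R' : ℕ) : ℤ := 3 * q + s₁ + 2 * R'

/-- **Region `k` of the rooted straight run**: as `Adv.region`, but region `0` reaches only `ρ₀ = 3q + s₁ + 2R'` below the start box.
[cite: KozmaNitzan2024, §4 Lemma 11 (p. 22: the slabs of Ω)] -/
def regionR (a : Fin 2) (σ : ℤ) (c : Site 2) (k : ℕ) : Finset (Site 2) :=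
  if k = 0 then sBox a σ c (-(ρ₀ q s₁ R')) (q + s₁) ρ else sBox a σ c (q + (k : ℤ) * s₁ - 2 * s₁) (q + (k : ℤ) * s₁ + s₁) ρ

variable {q q' s₁ ρ R' N}

/-- Away from step `0` the rooted regions are the standard ones. [folklore] -/
theorem regionR_of_ne_zero {a : Fin 2} {σ : ℤ} {c : Site 2} {k : ℕ} (hk : k ≠ 0) :
    regionR q s₁ ρ R' a σ c k = region q s₁ ρ a σ c k := by
  rw [regionR, if_neg hk, region, if_neg hk]

variable {ℓ₀ : ℕ} {a : Fin 2} {σ : ℤ} (hσ : σ = 1 ∨ σ = -1) (c : Site 2) (h : AdvOK q q' s₁ ρ R' ℓ₀ N)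
include hσ h

/-- **ROUTES of the rooted straight run** (`k ≤ N`, bounded scales `ℓ ≤ 2q + s₁ + R'`). [cite: KozmaNitzan2024, §4 Lemma 11 (pp. 22–23)] -/
theorem core_routeR_le {k : ℕ} (hk : k ≤ N) {v : Site 2}
    (hv : v ∈ sBox a σ c (coreα q s₁ k - R') (coreβ q s₁ k + R') (coreW q q' s₁ R' k + R')) :
    ∃ ℓ : ℕ, ℓ₀ ≤ ℓ ∧ (ℓ : ℤ) ≤ 2 * q + s₁ + R' ∧ shiftF v (box 2 ℓ) ⊆ regionR q s₁ ρ R' a σ c k ∧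
      ∃ τ : Fin 2 → ℤˣ, shiftF v (orthantFace a τ ℓ) ⊆ core q q' s₁ R' a σ c (k + 1) := by
  by_cases hk0 : k = 0
  · subst hk0
    obtain ⟨⟨e0α, e0β, e0W⟩, eF⟩ := core_params (q := q) (q' := q') (s₁ := s₁) (R' := R')
    have hq := h.hq; have hq' := h.hq'; have hs := h.hs; have hs2 := h.hs2; have hρ0 := h.hρ0; have hρ := h.hρ
    have hR0 : (0 : ℤ) ≤ R' := by positivity
    have hN0 : (0 : ℤ) ≤ N := by positivity
    have hNR : (0 : ℤ) ≤ (N : ℤ) * R' := by positivity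
    obtain ⟨e1α, e1β, e1W⟩ := eF 1 le_rfl
    rw [e0α, e0β, e0W] at hv
    obtain ⟨ℓ, hℓ0, hℓhi, hsq, τ, hface⟩ := route_start₂ hσ c (q := q) (q' := q') (s := s₁) (w₁ := w₁ q q' s₁ R')
      (ρ := ρ) (R' := R') (ℓ₀ := ℓ₀) hs (by unfold w₁; linarith) (by nlinarith) hρ0 hv
    refine ⟨ℓ, hℓ0, hℓhi, by rw [regionR, if_pos rfl, ρ₀]; exact hsq, τ, ?_⟩
    rw [core, e1α, e1β, e1W]
    convert hface using 2 <;> push_cast <;> ring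
  · rw [regionR_of_ne_zero hk0]
    exact core_route_le hσ c h hk hv

/-- **The `R'`-enlargement of core `k ≤ N` lies in the rooted region `k`.** [cite: KozmaNitzan2024, §4 Lemma 11 (p. 22)] -/
theorem enlarge_core_subset_regionR {k : ℕ} (hk : k ≤ N) :
    sBox a σ c (coreα q s₁ k - R') (coreβ q s₁ k + R') (coreW q q' s₁ R' k + R') ⊆ regionR q s₁ ρ R' a σ c k := by
  by_cases hk0 : k = 0
  · subst hk0
    obtain ⟨⟨e0α, e0β, e0W⟩, -⟩ := core_params (q := q) (q' := q') (s₁ := s₁) (R' := R')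
    have hq := h.hq; have hq' := h.hq'; have hs := h.hs; have hs2 := h.hs2; have hρ := h.hρ
    have hR0 : (0 : ℤ) ≤ R' := by positivity
    have hNR : (0 : ℤ) ≤ (N : ℤ) * R' := by positivity
    rw [e0α, e0β, e0W, regionR, if_pos rfl, ρ₀]
    exact sBox_mono hσ c (by linarith) (by linarith) (by linarith)
  · rw [regionR_of_ne_zero hk0]
    exact enlarge_core_subset_region hσ c h hk

/-- **The next core lies in the rooted region `k`** (`k ≤ N`). [cite: KozmaNitzan2024, §4 Lemma 11 (p. 22)] -/
theorem core_succ_subset_regionR {k : ℕ} (hk : k ≤ N) : core q q' s₁ R' a σ c (k + 1) ⊆ regionR q s₁ ρ R' a σ c k := by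
  by_cases hk0 : k = 0
  · subst hk0
    obtain ⟨-, eF⟩ := core_params (q := q) (q' := q') (s₁ := s₁) (R' := R')
    have hq := h.hq; have hq' := h.hq'; have hs := h.hs; have hs2 := h.hs2; have hρ := h.hρ
    have hR0 : (0 : ℤ) ≤ R' := by positivity
    have hNR : (0 : ℤ) ≤ (N : ℤ) * R' := by positivity
    obtain ⟨eα, eβ, eW⟩ := eF 1 le_rfl
    rw [core, eα, eβ, eW, regionR, if_pos rfl, ρ₀]
    push_cast
    exact sBox_mono hσ c (by linarith) (by linarith) (by unfold w₁; linarith)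
  · rw [regionR_of_ne_zero hk0]
    exact core_succ_subset_region hσ c h hk

/-- **All rooted regions lie in the prism** `{-(3q + s₁ + 2R') ≤ level ≤ q + (N+1)s₁, |trans| ≤ ρ}`. [cite: KozmaNitzan2024, §4 Lemma 11 (p. 22: Ω)] -/
theorem regionR_subset_prism {k : ℕ} (hk : k ≤ N) :
    regionR q s₁ ρ R' a σ c k ⊆ sBox a σ c (-(ρ₀ q s₁ R')) (q + ((N : ℤ) + 1) * s₁) ρ := by
  have hq := h.hq; have hs := h.hs; have hs2 := h.hs2
  have hR0 : (0 : ℤ) ≤ R' := by positivity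
  have hs0 : 0 ≤ s₁ := by linarith
  have hNs : (0 : ℤ) ≤ (N : ℤ) * s₁ := by positivity
  by_cases hk0 : k = 0
  · subst hk0; rw [regionR, if_pos rfl]
    exact sBox_mono hσ c le_rfl (by nlinarith) le_rfl
  · have hk1 : 1 ≤ k := by omega
    rw [regionR, if_neg hk0, ρ₀]
    have hks : (k : ℤ) * s₁ ≤ (N : ℤ) * s₁ := mul_le_mul_of_nonneg_right (by exact_mod_cast hk) hs0
    have hks1 : s₁ ≤ (k : ℤ) * s₁ := by
      have : (1 : ℤ) * s₁ ≤ (k : ℤ) * s₁ := mul_le_mul_of_nonneg_right (by exact_mod_cast hk1) hs0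
      linarith
    exact sBox_mono hσ c (by linarith) (by linarith) le_rfl

end Adv

end ChainPlanar

end Transplant

end Summit.CriticalPhenomena.PercolationContinuityZ3.Theorems

end
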